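import Literature.NumberTheory.ComplexMultiplication.CMTypeRankSameSlotFamilies
import HarnessLib

/-!
# Same-field families of CM types: nondegenerate ⟹ at most `n` members with independent type vectors; under
# multiplicity one of the odd weights every type is nondegenerate and the family rank is read off the type vectors

Companion of `NumberTheory/ComplexMultiplication/CMTypeRankSameSlotFamilies` (same-slot families `Φ_i ⊆ X`, all slots
one `G`-set `X` — Deligne's CM algebra `K^I`, LNM 900 I Ex. 3.7: additivity `U(Σ) = ⊕_i U(Φ_i)` forces the type vectors
`u_1(Φ_i) ∈ ℚ^X` to be linearly independent, and conversely under the multiplicity-one hypothesis (M1)) and of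
`CMTypeRankEvaluationCriterion`.  This file states the consequences for the RANK OF RECORD `typeRank`:

* `typeRank_eq_of_typeRank_sigmaType_eq` / `forall_map_slotExt_le_of_typeRank_sigmaType_eq` — a NONDEGENERATE family
  (`rank(Σ) = |⊔ E_i|/2 + 1`) has nondegenerate members and is additive (Hazama's remark, Gordon 7.6.1: sub-products of
  a stably nondegenerate product are stably nondegenerate);
* **`linearIndependent_antiVec_one_of_typeRank_sigmaType_eq`, `card_le_card_div_two_of_typeRank_sigmaType_eq`** —
  for ANY `X` with a CM conjugation `ρ` (any CM field `K`, `X = Hom(K, ℂ)`, `|X| = 2n`): a nondegenerate same-slot family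
  has linearly independent type vectors, all inside the `n`-dimensional odd weights, hence AT MOST `n` MEMBERS — at most
  `n` pairwise CM-inequivalent CM types of one CM field of degree `2n` can have `Hg(∏ A_i) = ∏ Hg(A_i)`;
* under (M1) (every equivariant `T : ℚ^X → ℚ^X` with `ρ`-odd values is a multiple of `f ↦ f − f∘ρ`):
  **`antiSpan_eq_antiWeights_of_multiplicityOne`, `typeRank_eq_of_multiplicityOne`** — EVERY CM type for `ρ` is
  nondegenerate (its translates span the odd weights, an irreducible `G`-module), and
  **`typeRank_sigmaType_eq_iff_linearIndependent_of_multiplicityOne`** — a same-slot family is nondegenerate ⟺ its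
  type vectors are linearly independent.

Theorems only: no definition, no named fact, no `sorry`.

## References

* [Gordon1999HodgeAVSurvey] B. B. Gordon, *A survey of the Hodge conjecture for abelian varieties*, 7.5–7.7.
* [Deligne1982HodgeCycles] P. Deligne, *Hodge cycles on abelian varieties*, LNM 900 (1982), I Ex. 3.7.
* [Mai1989] L. Mai, *Lower bounds for the ranks of CM types*, J. Number Theory 32 (1989), §2 Prop. 1 (proof).
* [Kubota1965] T. Kubota, *On the field extension by complex multiplication*, Trans. AMS 118 (1965), §2.
-/

set_option autoImplicit false

noncomputable section

open scoped BigOperators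

universe u v w

namespace Literature.NumberTheory.ComplexMultiplication

variable {G : Type w} [Group G] {I : Type u} {E : I → Type v} [∀ i, MulAction G (E i)]

/-! ### §1 A nondegenerate family has nondegenerate members and is additive -/

section Nondegenerate

variable [DecidableEq I] [Fintype I] [∀ i, Fintype (E i)] [Nonempty I] [∀ i, Nonempty (E i)]

omit [DecidableEq I] in
/-- **Every member of a nondegenerate family is nondegenerate** (`rank(Σ) − 1 ≤ Σ_i (rank(Φ_i) − 1)` and
`rank(Φ_i) − 1 ≤ |E_i|/2` termwise).  On abelian varieties: a factor of a stably nondegenerate product is stably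
nondegenerate. [cite: Gordon1999HodgeAVSurvey, 7.6.1] -/
theorem typeRank_eq_of_typeRank_sigmaType_eq {ρ : G} {Φ : ∀ i, Set (E i)} (h : ∀ i, IsCMTypeWith ρ (Φ i))
    (hnd : typeRank G (sigmaType Φ) = Fintype.card (Σ i, E i) / 2 + 1) (i : I) :
    typeRank G (Φ i) = Fintype.card (E i) / 2 + 1 := by
  have hsum := typeRank_sigmaType_add_card_le h
  have hle : ∀ j, typeRank G (Φ j) ≤ Fintype.card (E j) / 2 + 1 := fun j => (h j).typeRank_le
  have htot : ∑ j, (Fintype.card (E j) / 2 + 1) = (∑ j, Fintype.card (E j) / 2) + Fintype.card I := by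
    rw [Finset.sum_add_distrib, Finset.sum_const, Finset.card_univ, smul_eq_mul, mul_one]
  rw [hnd, card_sigma_div_two h] at hsum
  by_contra hne
  have hlt : typeRank G (Φ i) < Fintype.card (E i) / 2 + 1 := lt_of_le_of_ne (hle i) hne
  have hsum_lt : ∑ j, typeRank G (Φ j) < ∑ j, (Fintype.card (E j) / 2 + 1) :=
    Finset.sum_lt_sum (fun j _ => hle j) ⟨i, Finset.mem_univ i, hlt⟩
  rw [htot] at hsum_lt
  omega

/-- **A nondegenerate family is additive**: `ext_i U(Φ_i) ≤ U(Σ)` for all `i` (`Hg(∏ A_i) = ∏ Hg(A_i)`).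
[cite: Gordon1999HodgeAVSurvey, 7.5–7.6] -/
theorem forall_map_slotExt_le_of_typeRank_sigmaType_eq {ρ : G} {Φ : ∀ i, Set (E i)} (h : ∀ i, IsCMTypeWith ρ (Φ i))
    (hnd : typeRank G (sigmaType Φ) = Fintype.card (Σ i, E i) / 2 + 1) :
    ∀ i, (antiSpan G (Φ i)).map (slotExt i) ≤ antiSpan G (sigmaType Φ) :=
  (forall_map_slotExt_le_iff_typeRank_sigmaType_eq h (typeRank_eq_of_typeRank_sigmaType_eq h hnd)).2 hnd

end Nondegenerate

/-! ### §2 Same-slot families: a nondegenerate family has at most `n` members -/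

section SameSlot

variable {X : Type v} [MulAction G X] [Fintype X] [Nonempty X] [DecidableEq I] [Fintype I] [Nonempty I]

/-- **A nondegenerate same-slot family of CM types has linearly independent type vectors** `u_1(Φ_i) ∈ ℚ^X`.
[cite: Mai1989, §2 Prop. 1 (proof)] [cite: Gordon1999HodgeAVSurvey, 7.5–7.6] -/
theorem linearIndependent_antiVec_one_of_typeRank_sigmaType_eq {ρ : G} (Φ : I → Set X)
    (h : ∀ i, IsCMTypeWith ρ (Φ i))
    (hnd : typeRank G (sigmaType (E := fun _ : I => X) Φ) = Fintype.card (Σ _ : I, X) / 2 + 1) :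
    LinearIndependent ℚ fun i => antiVec (Φ i) (1 : G) :=
  linearIndependent_antiVec_one_of_forall_map_slotExt_le Φ
    (forall_map_slotExt_le_of_typeRank_sigmaType_eq (E := fun _ : I => X) h hnd)

omit [Fintype X] [Nonempty X] in
/-- The type vector of a CM type for `ρ` is a `ρ`-odd weight. [cite: Kubota1965, §2 (p. 115)] -/
theorem antiVec_mem_antiWeights {ρ : G} {Ψ : Set X} (h : IsCMTypeWith ρ Ψ) (g : G) :
    antiVec Ψ g ∈ antiWeights (E := X) ρ := fun x => by
  simp only [antiVec, h.translateInd_rho_smul]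
  ring

omit [Fintype X] [Nonempty X] in
/-- `U(Ψ)` lies in the `ρ`-odd weights. [cite: Kubota1965, §2 (p. 115)] -/
theorem antiSpan_le_antiWeights' {ρ : G} {Ψ : Set X} (h : IsCMTypeWith ρ Ψ) :
    antiSpan G Ψ ≤ antiWeights (E := X) ρ :=
  Submodule.span_le.2 (by rintro _ ⟨g, rfl⟩; exact antiVec_mem_antiWeights h g)

/-- `dim` of the `ρ`-odd weights is `|X|/2` when some CM type for `ρ` is nondegenerate. [cite: Kubota1965, §2 (p. 115)] -/
theorem finrank_antiWeights_eq_of_typeRank_eq {ρ : G} {Ψ : Set X} (h : IsCMTypeWith ρ Ψ)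
    (hnd : typeRank G Ψ = Fintype.card X / 2 + 1) : Module.finrank ℚ (antiWeights (E := X) ρ) = Fintype.card X / 2 := by
  have h1 := (h.typeRank_eq_iff_antiSpan_eq.1 hnd)
  have h2 := h.typeRank_eq_finrank_antiSpan_add_one
  rw [h1, hnd] at h2
  omega

/-- **A nondegenerate same-slot family of CM types on `X` (`|X| = 2n`) has at most `n` members**: its type vectors are
linearly independent `ρ`-odd weights.  (At most `n` pairwise CM-inequivalent CM types of ONE CM field of degree `2n`
have `Hg(∏_i A_{Φ_i}) = ∏_i Hg(A_{Φ_i})`.) [cite: Gordon1999HodgeAVSurvey, 7.7] [cite: Mai1989, §2 Prop. 1 (proof)] -/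
theorem card_le_card_div_two_of_typeRank_sigmaType_eq {ρ : G} (Φ : I → Set X) (h : ∀ i, IsCMTypeWith ρ (Φ i))
    (hnd : typeRank G (sigmaType (E := fun _ : I => X) Φ) = Fintype.card (Σ _ : I, X) / 2 + 1) :
    Fintype.card I ≤ Fintype.card X / 2 := by
  obtain ⟨i₀⟩ := ‹Nonempty I›
  have hli := linearIndependent_antiVec_one_of_typeRank_sigmaType_eq Φ h hnd
  have hmem : ∀ i, antiVec (Φ i) (1 : G) ∈ antiWeights (E := X) ρ := fun i => antiVec_mem_antiWeights (h i) 1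
  rw [← finrank_antiWeights_eq_of_typeRank_eq (h i₀)
    (typeRank_eq_of_typeRank_sigmaType_eq (E := fun _ : I => X) h hnd i₀)]
  exact card_le_finrank_of_linearIndependent Φ hmem hli

end SameSlot

/-! ### §3 Multiplicity one of the odd weights: every type is nondegenerate; family rank from the type vectors -/

section MultiplicityOne

variable {X : Type v} [MulAction G X] [Fintype X] [Nonempty X]

/-- **Under (M1) the translates of ANY CM type span the odd weights**: `U(Φ) = Anti` (the odd weights are an irreducible
`G`-module met by `u_1(Φ) ≠ 0`). [cite: Kubota1965, §2 (p. 115)] [cite: Mai1989, §2 Prop. 1 (proof)] -/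
theorem antiSpan_eq_antiWeights_of_multiplicityOne {ρ : G} {Φ : Set X} (h : IsCMTypeWith ρ Φ)
    (hM1 : ∀ T : (X → ℚ) →ₗ[ℚ] (X → ℚ), (∀ (g : G) (f : X → ℚ), T (fun x => f (g⁻¹ • x)) = fun x => T f (g⁻¹ • x)) →
      (∀ f x, T f (ρ • x) = -T f x) → ∃ c : ℚ, ∀ f, T f = c • fun x => f x - f (ρ • x)) :
    antiSpan G Φ = antiWeights (E := X) ρ := by
  let A : Submodule ℚ (X → ℚ) := antiWeights ρ
  have hmemA : ∀ f : X → ℚ, f ∈ A ↔ ∀ x, f (ρ • x) = -f x := fun f => Iff.rfl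
  let P : (X → ℚ) →ₗ[ℚ] (X → ℚ) := (1 / 2 : ℚ) • (LinearMap.id - LinearMap.funLeft ℚ ℚ fun x : X => ρ • x)
  have hP : ∀ f x, P f x = (1 / 2 : ℚ) * (f x - f (ρ • x)) := fun f x => rfl
  have hPid : ∀ a ∈ A, P a = a := fun a ha => by
    funext x
    rw [hP, (hmemA a).1 ha x]
    ring
  have hM1' : ∀ T : (X → ℚ) →ₗ[ℚ] (X → ℚ), (∀ (g : G) (f : X → ℚ), T (fun x => f (g⁻¹ • x)) = fun x => T f (g⁻¹ • x)) →
      (∀ f, T f ∈ A) → ∃ c : ℚ, ∀ f, T f = c • P f := fun T hT hTA => by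
    obtain ⟨c, hc⟩ := hM1 T hT fun f => (hmemA _).1 (hTA f)
    refine ⟨2 * c, fun f => ?_⟩
    rw [hc f]
    funext x
    simp only [Pi.smul_apply, hP, smul_eq_mul]
    ring
  rcases eq_bot_or_eq_of_multiplicityOne (G := G) P hPid hM1' (antiSpan_le_antiWeights' h)
      (fun g f hf => comp_smul_mem_antiSpan hf g) with h0 | hA
  · exfalso
    have hu : antiVec Φ (1 : G) ∈ antiSpan G Φ := Submodule.subset_span ⟨1, rfl⟩
    rw [h0, Submodule.mem_bot] at hu
    obtain ⟨x⟩ := ‹Nonempty X›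
    have hx := congrFun hu x
    simp only [antiVec, Pi.zero_apply] at hx
    by_cases hm : (1 : G) • x ∈ Φ
    · rw [translateInd_of_mem hm] at hx; norm_num at hx
    · rw [translateInd_of_not_mem hm] at hx; norm_num at hx
  · exact hA

/-- **Under (M1) every CM type for `ρ` is nondegenerate**: `rank(Φ) = |X|/2 + 1`. [cite: Kubota1965, §2 (p. 115)]
[cite: Mai1989, §2 Prop. 1 (proof)] -/
theorem typeRank_eq_of_multiplicityOne {ρ : G} {Φ : Set X} (h : IsCMTypeWith ρ Φ)
    (hM1 : ∀ T : (X → ℚ) →ₗ[ℚ] (X → ℚ), (∀ (g : G) (f : X → ℚ), T (fun x => f (g⁻¹ • x)) = fun x => T f (g⁻¹ • x)) →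
      (∀ f x, T f (ρ • x) = -T f x) → ∃ c : ℚ, ∀ f, T f = c • fun x => f x - f (ρ • x)) :
    typeRank G Φ = Fintype.card X / 2 + 1 :=
  h.typeRank_eq_iff_antiSpan_eq.2 (antiSpan_eq_antiWeights_of_multiplicityOne h hM1)

variable [DecidableEq I] [Fintype I] [Nonempty I]

/-- **Under (M1) a same-slot family of CM types is nondegenerate ⟺ its type vectors `u_1(Φ_i) ∈ ℚ^X` are linearly
independent** (`rank(⊔_i {i} × Φ_i) = |I|·|X|/2 + 1 ⟺ …`; on abelian varieties with CM by one field `K`: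
`Hg(∏ A_{Φ_i}) = ∏ Hg(A_{Φ_i})` with every `A_{Φ_i}` nondegenerate). [cite: Mai1989, §2 Prop. 1 (proof)]
[cite: Deligne1982HodgeCycles, I Ex. 3.7] -/
theorem typeRank_sigmaType_eq_iff_linearIndependent_of_multiplicityOne {ρ : G} (Φ : I → Set X)
    (h : ∀ i, IsCMTypeWith ρ (Φ i))
    (hM1 : ∀ T : (X → ℚ) →ₗ[ℚ] (X → ℚ), (∀ (g : G) (f : X → ℚ), T (fun x => f (g⁻¹ • x)) = fun x => T f (g⁻¹ • x)) →
      (∀ f x, T f (ρ • x) = -T f x) → ∃ c : ℚ, ∀ f, T f = c • fun x => f x - f (ρ • x)) :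
    typeRank G (sigmaType (E := fun _ : I => X) Φ) = Fintype.card (Σ _ : I, X) / 2 + 1 ↔
      LinearIndependent ℚ fun i => antiVec (Φ i) (1 : G) := by
  rw [← forall_map_slotExt_le_iff_typeRank_sigmaType_eq (E := fun _ : I => X) h
    fun i => typeRank_eq_of_multiplicityOne (h i) hM1]
  exact forall_map_slotExt_le_iff_linearIndependent_of_isCMTypeWith Φ h hM1

end MultiplicityOne

end Literature.NumberTheory.ComplexMultiplication
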